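import Mathlib
import HarnessLib
import Summits.NavierStokesRegularity.NavierStokesRegularity.Theorems.PoloidalWindowDoorPoloidalWindowRigidityTimeShearPast
import Summits.NavierStokesRegularity.NavierStokesRegularity.Theorems.PoloidalWindowDoorPoloidalWindowRigiditySymmetryGerms

/-!
# Route `PoloidalWindowDoor`, crux `PoloidalWindowRigidity` (K2, stmt-NavierStokesRegularity-19708) —
# THE ASYMPTOTIC STRATUM PRINCIPLE: every one-slice gradient stratum of the poloidal class is also EMPTY ASYMPTOTICALLY
# at `t = −∞`, along ANY sequence of far-past times (reusable engine + three instances)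

Cell ns-regularity-ideate, K2 lead ns-poloidal-K2-p1 (gen 4; class-level tool, `--supports stmt-…-19708`).  Packages the
mechanism of `…HorizontalFlatPast` / `…TimeShearPast` (this lead) and `…OneDirectionPast` (ns-poloidal-K2-p2) once and for
all, so that further asymptotic strata cost one stratum theorem and ten lines:

* `exists_zoomOut_of_asymptotic_defect` — **THE ENGINE.**  Let `D` be a continuous «defect» on velocity gradients,
  positively homogeneous (`D(c • A) = c · D(A)` for `c ≥ 0`; e.g. the norm of any linear image of `A`).  If a NONTRIVIAL
  poloidal profile of the route's Type-I class is FREQUENTLY asymptotically `D`-degenerate —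
  `∀ δ > 0 ∀ T ∃ t < T ∀ x, (−t)|D(Dv(t)(x))| ≤ δ` (degenerate in scale-invariant size along SOME sequence of far-past
  times) — then there is a nontrivial poloidal member `W` of the KNSS class `𝔓(C)` whose hot-spot slice is EXACTLY
  `D`-degenerate: `D(DW(−1)(y)) = 0` for all `y`, `W(−1,0) ≠ 0`.  (Forward ε-regularity `…ForwardSmallness` puts bad points
  on the prescribed slices; `…TimeShearPast.exists_zoomOut_fderiv` zooms out there with gradients.)
* `eq_zero_of_asymptotic_defect` — hence, if the one-slice stratum `{D(DW(s)) ≡ 0}` is empty in the poloidal class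
  (hypothesis `hstratum`, to be discharged by a tree theorem), the profile is trivial.
* INSTANCES (each a new settled asymptotic stratum, «frequently» = along some sequence `t → −∞`):
  `eq_zero_of_frequently_irrotational` — `(−t)‖curl v(t)‖_∞` comes arbitrarily close to `0` ⇒ `v ≡ 0` (stratum:
  nsreg-p7's `…SymmetryGerms.eq_zero_of_curl_eq_zero_on_open`); `eq_zero_of_frequently_oneDirection` — for a fixed
  `e ≠ 0`, `(−t)‖Dv(t)[e]‖_∞` comes arbitrarily close to `0` ⇒ `v ≡ 0` (sharpens K2-p2's `…OneDirectionPast`, which needed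
  the limit; stratum `…SymmetryGerms.eq_zero_of_fderiv_apply_eq_zero_on_open`); `eq_zero_of_frequently_flat` — for a
  horizontal `a ≠ 0`, `(−t)‖⟪Dv(t)[a], e₃⟫‖_∞` comes arbitrarily close to `0` ⇒ `v ≡ 0` (sharpens this lead's
  `…HorizontalFlatPast`; stratum nsreg-p6's `…OneSlice.eq_zero_of_flat_slice`).

Reading for the residue of K2: a nontrivial poloidal Type-I profile keeps, at EVERY far-past time, a definite
scale-invariant amount of vorticity, of dependence on every direction, and of horizontal slope of its vertical velocity.

WHAT THIS IS NOT: not a claim about Navier–Stokes regularity and not the open stubs — a class-level engine and three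
settled asymptotic strata (bears_on LADDER-NS N0, rung N0-LocalTubeDoorPoloidal).
-/

noncomputable section

-- the summit and its single sub-problem share the name (CONVENTIONS §1), as in every Theorems file
set_option linter.dupNamespace false

namespace Summit.NavierStokesRegularity.NavierStokesRegularity.Theorems.PoloidalWindowDoorPoloidalWindowRigidityAsymptoticStratum

open MeasureTheory Set Function Filter Topology
open scoped RealInnerProductSpace InnerProductSpace
open Literature.Analysis Literature.Analysis.FluidPDE
open Summit.NavierStokesRegularity.NavierStokesRegularity.Theorems
open Summit.NavierStokesRegularity.NavierStokesRegularity.Theorems.PoloidalWindowDoorPoloidalWindowRigidityZoomOut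
open Summit.NavierStokesRegularity.NavierStokesRegularity.Theorems.PoloidalWindowDoorPoloidalWindowRigidityOneSlice
open Summit.NavierStokesRegularity.NavierStokesRegularity.Theorems.PoloidalWindowDoorPoloidalWindowRigidityWindow
open Summit.NavierStokesRegularity.NavierStokesRegularity.Theorems.PoloidalWindowDoorPoloidalWindowRigidityFlat
open Summit.NavierStokesRegularity.NavierStokesRegularity.Theorems.PoloidalWindowDoorPoloidalWindowRigidityForwardSmallness
open Summit.NavierStokesRegularity.NavierStokesRegularity.Theorems.PoloidalWindowDoorPoloidalWindowRigidityTimeShearPast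
open Summit.NavierStokesRegularity.NavierStokesRegularity.Theorems.PoloidalWindowDoorPoloidalWindowRigiditySymmetryGerms

variable {C : ℝ} {v : ℝ → EuclideanSpace ℝ (Fin 3) → EuclideanSpace ℝ (Fin 3)}

/-! ### the engine -/

/-- **THE ASYMPTOTIC STRATUM ENGINE.**  Let `v` be a NONTRIVIAL profile of the route's Type-I class, poloidal along `e₃`
on every slice, and let `D` be a continuous, positively homogeneous defect on gradients (`D(c • A) = c · D(A)`, `c ≥ 0`).
If `v` is frequently asymptotically `D`-degenerate, `∀ δ > 0 ∀ T ∃ t < T ∀ x, (−t)|D(Dv(t)(x))| ≤ δ`, then some nontrivial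
poloidal member `W` of `𝔓(C)` has an exactly `D`-degenerate hot-spot slice: `W(−1,0) ≠ 0` and `D(DW(−1)(y)) = 0` for
every `y`. -/
theorem exists_zoomOut_of_asymptotic_defect (hrate : HasTypeITimeDecay C v)
    (hcont : ContinuousOn (uncurry v) (Iio (0 : ℝ) ×ˢ univ))
    (hmild : ∀ s t : ℝ, s < t → t < 0 → ∀ x,
      v t x = UnboundedOperators.heatExtension (v s) (t - s) x - oseenDuhamel 1 s v v t x)
    (hdiv : ∀ t < 0, VectorCalculus.IsDivFree (v t))
    (hpol : ∀ s < 0, ∀ y, ⟪curl (v s) y, EuclideanSpace.single 2 (1 : ℝ)⟫_ℝ = 0)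
    (hne : ∃ t < 0, ∃ x, v t x ≠ 0)
    {D : (EuclideanSpace ℝ (Fin 3) →L[ℝ] EuclideanSpace ℝ (Fin 3)) → ℝ} (hDc : Continuous D)
    (hD : ∀ (c : ℝ) (A : EuclideanSpace ℝ (Fin 3) →L[ℝ] EuclideanSpace ℝ (Fin 3)), 0 ≤ c → D (c • A) = c * D A)
    (hdef : ∀ δ : ℝ, 0 < δ → ∀ T : ℝ, ∃ t < T, ∀ x, (-t) * |D (fderiv ℝ (v t) x)| ≤ δ) :
    ∃ W : ℝ → EuclideanSpace ℝ (Fin 3) → EuclideanSpace ℝ (Fin 3), IsTypeIAncientMild C W ∧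
      (∀ s < 0, ∀ y, ⟪curl (W s) y, EuclideanSpace.single 2 (1 : ℝ)⟫_ℝ = 0) ∧ W (-1) 0 ≠ 0 ∧
      ∀ y, D (fderiv ℝ (W (-1)) y) = 0 := by
  obtain ⟨ε, hε, T₀, hT₀, hbadT⟩ := exists_uniformly_nonsmall hrate hmild hne
  -- ## degenerate far-past slices, and bad points on them
  have hch : ∀ k : ℕ, ∃ t : ℝ, t < T₀ ∧ (∀ x, (-t) * |D (fderiv ℝ (v t) x)| ≤ 1 / ((k : ℝ) + 1)) ∧
      ∃ x, ε < Real.sqrt (-t) * ‖v t x‖ := by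
    intro k
    obtain ⟨τ, hτ, hDτ⟩ := hdef (1 / ((k : ℝ) + 1)) (by positivity) T₀
    obtain ⟨x, hx⟩ := hbadT τ hτ
    exact ⟨τ, hτ, hDτ, x, hx⟩
  choose tk htkT hDk xk hxk using hch
  have htk0 : ∀ k, tk k < 0 := fun k => (htkT k).trans hT₀
  -- ## zoom out there
  obtain ⟨φ, W, hφ, hW, hWpol, hnorm, hDW⟩ :=
    exists_zoomOut_fderiv hrate hcont hmild hdiv hpol htk0 fun k => (hxk k).le
  refine ⟨W, hW, hWpol, fun h0 => ?_, fun y => ?_⟩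
  · rw [h0, norm_zero] at hnorm
    linarith
  · have hs1 : (-1 : ℝ) < 0 := by norm_num
    -- the scalar sequence `D((−t_k) • Dv(t_k)(x_k + √(−t_k) y)) = (−t_k) D(Dv(…))`
    set g : ℕ → ℝ := fun j => D ((-tk (φ j)) •
      fderiv ℝ (v (-tk (φ j) * (-1))) (xk (φ j) + Real.sqrt (-tk (φ j)) • y)) with hg
    have hlim : Tendsto g atTop (𝓝 (D (fderiv ℝ (W (-1)) y))) :=
      (hDc.tendsto _).comp (hDW (-1) hs1 y)
    have hbd : ∀ j, |g j| ≤ 1 / (((φ j : ℕ) : ℝ) + 1) := by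
      intro j
      have hnt : 0 ≤ -tk (φ j) := (neg_pos.2 (htk0 _)).le
      have e1 : -tk (φ j) * (-1) = tk (φ j) := by ring
      simp only [hg, e1]
      rw [hD _ _ hnt, abs_mul, abs_of_nonneg hnt]
      exact hDk (φ j) _
    have hzero : Tendsto g atTop (𝓝 0) := by
      have hb : Tendsto (fun j => 1 / ((((φ j : ℕ) : ℝ)) + 1)) atTop (𝓝 0) :=
        (tendsto_one_div_add_atTop_nhds_zero_nat (𝕜 := ℝ)).comp hφ.tendsto_atTop
      exact squeeze_zero_norm (fun j => by rw [Real.norm_eq_abs]; exact hbd j) hb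
    exact tendsto_nhds_unique hlim hzero

/-- **THE ASYMPTOTIC STRATUM PRINCIPLE.**  In the situation of `exists_zoomOut_of_asymptotic_defect`, if the one-slice
stratum `{D(DW(−1)(·)) ≡ 0}` contains no nontrivial poloidal member of `𝔓(C)` (`hstratum`), then a poloidal profile that
is frequently asymptotically `D`-degenerate vanishes identically. -/
theorem eq_zero_of_asymptotic_defect (hrate : HasTypeITimeDecay C v)
    (hcont : ContinuousOn (uncurry v) (Iio (0 : ℝ) ×ˢ univ))
    (hmild : ∀ s t : ℝ, s < t → t < 0 → ∀ x,
      v t x = UnboundedOperators.heatExtension (v s) (t - s) x - oseenDuhamel 1 s v v t x)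
    (hdiv : ∀ t < 0, VectorCalculus.IsDivFree (v t))
    (hpol : ∀ s < 0, ∀ y, ⟪curl (v s) y, EuclideanSpace.single 2 (1 : ℝ)⟫_ℝ = 0)
    {D : (EuclideanSpace ℝ (Fin 3) →L[ℝ] EuclideanSpace ℝ (Fin 3)) → ℝ} (hDc : Continuous D)
    (hD : ∀ (c : ℝ) (A : EuclideanSpace ℝ (Fin 3) →L[ℝ] EuclideanSpace ℝ (Fin 3)), 0 ≤ c → D (c • A) = c * D A)
    (hstratum : ∀ W : ℝ → EuclideanSpace ℝ (Fin 3) → EuclideanSpace ℝ (Fin 3), IsTypeIAncientMild C W →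
      (∀ s < 0, ∀ y, ⟪curl (W s) y, EuclideanSpace.single 2 (1 : ℝ)⟫_ℝ = 0) →
      (∀ y, D (fderiv ℝ (W (-1)) y) = 0) → ∀ t < 0, ∀ x, W t x = 0)
    (hdef : ∀ δ : ℝ, 0 < δ → ∀ T : ℝ, ∃ t < T, ∀ x, (-t) * |D (fderiv ℝ (v t) x)| ≤ δ) :
    ∀ t < 0, ∀ x, v t x = 0 := by
  by_contra hne
  push Not at hne
  obtain ⟨W, hW, hWpol, hW0, hDW⟩ :=
    exists_zoomOut_of_asymptotic_defect hrate hcont hmild hdiv hpol hne hDc hD hdef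
  exact hW0 (hstratum W hW hWpol hDW (-1) (by norm_num) 0)

/-! ### instance 1: frequently asymptotically irrotational -/

/-- **FREQUENTLY ASYMPTOTICALLY IRROTATIONAL ⇒ TRIVIAL.**  A profile of the route's Type-I class, poloidal along `e₃`,
whose scale-invariant vorticity size `(−t)‖curl v(t)‖_∞` comes arbitrarily close to `0` along some sequence of far-past
times — `∀ δ > 0 ∀ T ∃ t < T ∀ x, (−t)‖curl v(t,x)‖ ≤ δ` — vanishes identically. -/
theorem eq_zero_of_frequently_irrotational (hrate : HasTypeITimeDecay C v)
    (hcont : ContinuousOn (uncurry v) (Iio (0 : ℝ) ×ˢ univ))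
    (hmild : ∀ s t : ℝ, s < t → t < 0 → ∀ x,
      v t x = UnboundedOperators.heatExtension (v s) (t - s) x - oseenDuhamel 1 s v v t x)
    (hdiv : ∀ t < 0, VectorCalculus.IsDivFree (v t))
    (hpol : ∀ s < 0, ∀ y, ⟪curl (v s) y, EuclideanSpace.single 2 (1 : ℝ)⟫_ℝ = 0)
    (hdef : ∀ δ : ℝ, 0 < δ → ∀ T : ℝ, ∃ t < T, ∀ x, (-t) * ‖curl (v t) x‖ ≤ δ) :
    ∀ t < 0, ∀ x, v t x = 0 := by
  refine eq_zero_of_asymptotic_defect hrate hcont hmild hdiv hpol (D := fun A => ‖curlCLM A‖)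
    (curlCLM.continuous.norm) (fun c A hc => by simp only [map_smul, norm_smul, Real.norm_of_nonneg hc])
    (fun W hW _ hDW => ?_) (fun δ hδ T => ?_)
  · -- the stratum: an irrotational slice kills the profile
    refine eq_zero_of_curl_eq_zero_on_open hW.hasTypeITimeDecay hW.continuousOn_uncurry
      (fun s t hst ht x => hW.mild_eq_heatExtension hst ht x) (fun t ht => hW.isDivFree ht)
      (s := -1) (by norm_num) isOpen_univ univ_nonempty fun y _ => ?_
    have h := hDW y
    rw [norm_eq_zero] at h
    rw [curl_eq_curlCLM, h]
  · obtain ⟨t, ht, h⟩ := hdef δ hδ T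
    refine ⟨t, ht, fun x => ?_⟩
    rw [abs_of_nonneg (norm_nonneg _), ← curl_eq_curlCLM]
    exact h x

/-! ### instance 2: frequently asymptotically two-dimensional (one direction) -/

/-- **FREQUENTLY ASYMPTOTICALLY TWO-DIMENSIONAL ⇒ TRIVIAL** (sharpens ns-poloidal-K2-p2's one-direction door at `−∞`,
which needed the limit, for poloidal profiles).  If for one `e ≠ 0` the scale-invariant directional derivative
`(−t)‖Dv(t)[e]‖_∞` comes arbitrarily close to `0` along some sequence of far-past times, the profile vanishes. -/
theorem eq_zero_of_frequently_oneDirection (hrate : HasTypeITimeDecay C v)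
    (hcont : ContinuousOn (uncurry v) (Iio (0 : ℝ) ×ˢ univ))
    (hmild : ∀ s t : ℝ, s < t → t < 0 → ∀ x,
      v t x = UnboundedOperators.heatExtension (v s) (t - s) x - oseenDuhamel 1 s v v t x)
    (hdiv : ∀ t < 0, VectorCalculus.IsDivFree (v t))
    (hpol : ∀ s < 0, ∀ y, ⟪curl (v s) y, EuclideanSpace.single 2 (1 : ℝ)⟫_ℝ = 0)
    {e : EuclideanSpace ℝ (Fin 3)} (he : e ≠ 0)
    (hdef : ∀ δ : ℝ, 0 < δ → ∀ T : ℝ, ∃ t < T, ∀ x, (-t) * ‖fderiv ℝ (v t) x e‖ ≤ δ) :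
    ∀ t < 0, ∀ x, v t x = 0 := by
  refine eq_zero_of_asymptotic_defect hrate hcont hmild hdiv hpol (D := fun A => ‖A e‖)
    ((ContinuousLinearMap.apply ℝ (EuclideanSpace ℝ (Fin 3)) e).continuous.norm)
    (fun c A hc => by simp only [_root_.smul_apply, norm_smul, Real.norm_of_nonneg hc])
    (fun W hW _ hDW => ?_) (fun δ hδ T => ?_)
  · exact eq_zero_of_fderiv_apply_eq_zero_on_open hW.hasTypeITimeDecay hW.continuousOn_uncurry
      (fun s t hst ht x => hW.mild_eq_heatExtension hst ht x) (fun t ht => hW.isDivFree ht)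
      (s := -1) (by norm_num) he isOpen_univ univ_nonempty fun y _ => norm_eq_zero.1 (hDW y)
  · obtain ⟨t, ht, h⟩ := hdef δ hδ T
    exact ⟨t, ht, fun x => by rw [abs_of_nonneg (norm_nonneg _)]; exact h x⟩

/-! ### instance 3: frequently asymptotically flat vertical velocity -/

/-- **FREQUENTLY ASYMPTOTICALLY FLAT ⇒ TRIVIAL** (sharpens this lead's `…HorizontalFlatPast`, which needed the limit).
If for one horizontal direction `a` (`a ≠ 0`, `⟪a, e₃⟫ = 0`) the scale-invariant slope `(−t)|⟪Dv(t)[a], e₃⟫|` of the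
vertical velocity comes arbitrarily close to `0`, uniformly in space, along some sequence of far-past times, the profile
vanishes. -/
theorem eq_zero_of_frequently_flat (hrate : HasTypeITimeDecay C v)
    (hcont : ContinuousOn (uncurry v) (Iio (0 : ℝ) ×ˢ univ))
    (hmild : ∀ s t : ℝ, s < t → t < 0 → ∀ x,
      v t x = UnboundedOperators.heatExtension (v s) (t - s) x - oseenDuhamel 1 s v v t x)
    (hdiv : ∀ t < 0, VectorCalculus.IsDivFree (v t))
    (hpol : ∀ s < 0, ∀ y, ⟪curl (v s) y, EuclideanSpace.single 2 (1 : ℝ)⟫_ℝ = 0)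
    {a : EuclideanSpace ℝ (Fin 3)} (ha : a ≠ 0) (ha3 : ⟪a, EuclideanSpace.single 2 (1 : ℝ)⟫_ℝ = 0)
    (hdef : ∀ δ : ℝ, 0 < δ → ∀ T : ℝ, ∃ t < T, ∀ x,
      (-t) * |⟪fderiv ℝ (v t) x a, EuclideanSpace.single 2 (1 : ℝ)⟫_ℝ| ≤ δ) :
    ∀ t < 0, ∀ x, v t x = 0 := by
  refine eq_zero_of_asymptotic_defect hrate hcont hmild hdiv hpol
    (D := fun A => ⟪A a, EuclideanSpace.single 2 (1 : ℝ)⟫_ℝ)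
    (((ContinuousLinearMap.apply ℝ (EuclideanSpace ℝ (Fin 3)) a).continuous).inner continuous_const)
    (fun c A _ => by simp only [_root_.smul_apply, inner_smul_left, conj_trivial])
    (fun W hW hWpol hDW => ?_) hdef
  exact eq_zero_of_flat_slice hW.hasTypeITimeDecay hW.continuousOn_uncurry
    (fun s t hst ht x => hW.mild_eq_heatExtension hst ht x) (fun t ht => hW.isDivFree ht)
    (s := -1) (by norm_num) (hWpol (-1) (by norm_num)) ha ha3 hDW

end Summit.NavierStokesRegularity.NavierStokesRegularity.Theorems.PoloidalWindowDoorPoloidalWindowRigidityAsymptoticStratum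

end
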